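import Literature.Geometry.Kaehler.ComplexTorusRealMultiplicationUnitSignatures
import Literature.NumberTheory.NumberFields.CubicFieldOneRealPlace
import Mathlib.Algebra.CubicDiscriminant
import Mathlib.FieldTheory.IntermediateField.Adjoin.Basic
import Mathlib.FieldTheory.IsAlgClosed.AlgebraicClosure
import Mathlib.Topology.Algebra.Polynomial
import Mathlib.Analysis.SpecialFunctions.Pow.Real
import Mathlib.NumberTheory.NumberField.InfinitePlace.TotallyRealComplex
import HarnessLib

/-!
# A KERNEL certificate for «the units of a totally real cubic field have all signatures»

Topic `NumberTheory/NumberFields`; namespace `Literature.NumberTheory.NumberFields` (sub-namespace `UnitSignature` for the unit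
statements, that of `UnitSignature.lean` / `UnitSignatureSurjective.lean`). Theorem-only file (no definition, no named fact, no
`sorry`), written by the prover seat `bsd-2adic-k4-w1` GEN 8 (cell `bsd-2adic`; input `hsig` of the Chevalley-with-signatures bound
`AmbiguousClass.padicValNat_two_card_fixed_add_one_le_of_signVec_surjective` for the TOTALLY REAL cubic point fields of K4's additive
census; closes nothing there).

For a cubic number field `K` the unit signature map `sign : 𝓞_Kˣ → 𝔽₂^{(K ↪ ℝ)}` (tree `ComplexTorus.signVec`, Fröhlich–Taylor V §1
(1.10)–(1.12)) is ONTO as soon as `K` has three distinct real embeddings `ρ₀, ρ₁, ρ₂` and two units `e₁, e₂` whose sign vectors at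
`(ρ₀, ρ₁, ρ₂)` are, together with that of `−1`, independent over `𝔽₂`: the eight units `± e₁^a e₂^b` then take all eight sign
vectors, and `ρ₀, ρ₁, ρ₂` are ALL the real embeddings (`r₁ ≤ [K : ℚ] = 3`). No Dirichlet unit theorem is needed. This file turns that
into a certificate a census row can discharge by rational arithmetic:

* §1 `quadratic_pos_of_endpoints` / `quadratic_neg_of_endpoints` — the sign of `a₀ + a₁ x + a₂ x²` on `[l, u]` from its values at the
  endpoints (`(u − l) f(x) = (u − x) f(l) + (x − l) f(u) + (u − l) a₂ (x − l)(x − u)`, `|(x − l)(x − u)| ≤ (u − l)²/4`);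
  `exists_cubic_root_Ioo_of_neg_of_pos` / `…_of_pos_of_neg` — a real root of a real cubic in an interval with a sign change (IVT).
* §2 `exists_ringHom_adjoin_apply_gen_eq` — a real root `x` of the (irreducible, monic) cubic of `θ` gives a real embedding
  `ρ : ℚ(θ) → ℝ` with `ρ(θ) = x` (Mathlib `IntermediateField.algHomAdjoinIntegralEquiv`).
* §3 `isTotallyReal_of_three_realEmbeddings` — `[K : ℚ] = 3` and three distinct real embeddings ⟹ `K` totally real
  (`r₁ + 2 r₂ = 3`, `r₁ ≥ 3`). §5 (appended) `card_ringHom_real_adjoin_eq_one_of_cubic_discr_neg` /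
  `subsingleton_ringHom_real_adjoin_of_cubic_discr_neg` — the COMPLEX case: `disc < 0` ⟹ `ℚ(θ)` has exactly one `ℚ(θ) →+* ℝ`
  (from `CubicFieldOneRealPlace`), the `[Subsingleton (K →+* ℝ)]` input of the cell's `ℓ = 2` ascent doors.
* §4 **`signVec_surjective_of_two_units`** — `[K : ℚ] = 3`, three distinct real embeddings `ρ`, units `e₁, e₂` with sign bits
  `s₁, s₂ : Fin 3 → 𝔽₂` at `ρ` such that `(a, b, c) ↦ (a + b s₁(j) + c s₂(j))_j` is injective on `𝔽₂³` (decidable) ⟹ `sign` is onto;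
  `signVec_apply_eq_one_of_neg` / `signVec_apply_eq_zero_of_pos` — the bit of a unit `a₀ + a₁ t + a₂ t²` at an embedding `ρ` with
  `ρ t = x` from the sign of `a₀ + a₁ x + a₂ x²`.

The intended consumer feeds §1 with three rational intervals isolating the real roots and the §1 endpoint test for each (unit, root).

## References

* A. Fröhlich, M. J. Taylor, *Algebraic Number Theory* (1991), Ch. V §1 (1.10)–(1.13), pp. 163–164 (unit signatures). [FrohlichTaylor1990]
* H. Cohen, *A Course in Computational Algebraic Number Theory* (1993), §4.1.3 (signature of `ℚ(θ)` = number of real roots; Sturm,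
  Algorithm 4.1.11). [Cohen1993]
* D. A. Marcus, *Number Fields*, 2nd ed. (2018), Ch. 5, Thm. 38 (Dirichlet). [Marcus2018]
-/

noncomputable section

open Polynomial NumberField Module

namespace Literature.NumberTheory.NumberFields

/-! ### §1 Elementary certificates on the real line -/

/-- **A quadratic is POSITIVE on `[l, u]` if it is `≥ m > 0` at both endpoints and `|a₂| (u − l)² < 4m`**: the chord lies above
`m` and the quadratic deviates from its chord by `a₂ (x − l)(x − u)`, of absolute value `≤ |a₂| (u − l)²/4 < m`.
[cite: Cohen1993, §4.1.3 (sign computations at the real roots; Algorithm 4.1.11)] -/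
theorem quadratic_pos_of_endpoints {a₀ a₁ a₂ l u m x : ℝ} (hl : l ≤ x) (hu : x ≤ u) (hm : 0 < m)
    (hfl : m ≤ a₀ + a₁ * l + a₂ * l ^ 2) (hfu : m ≤ a₀ + a₁ * u + a₂ * u ^ 2)
    (ha : |a₂| * (u - l) ^ 2 < 4 * m) : 0 < a₀ + a₁ * x + a₂ * x ^ 2 := by
  rcases eq_or_lt_of_le (hl.trans hu) with hlu | hlu
  · have hx : x = l := le_antisymm (hlu ▸ hu) hl
    subst hx
    linarith
  have hid : (u - l) * (a₀ + a₁ * x + a₂ * x ^ 2) =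
      (u - x) * (a₀ + a₁ * l + a₂ * l ^ 2) + (x - l) * (a₀ + a₁ * u + a₂ * u ^ 2) +
        (u - l) * (a₂ * ((x - l) * (x - u))) := by ring
  have h1 : (u - l) * m ≤ (u - x) * (a₀ + a₁ * l + a₂ * l ^ 2) + (x - l) * (a₀ + a₁ * u + a₂ * u ^ 2) := by
    nlinarith
  have hP0 : (x - l) * (x - u) ≤ 0 := by nlinarith
  have hP1 : -((u - l) ^ 2 / 4) ≤ (x - l) * (x - u) := by nlinarith [sq_nonneg (x - l - (u - x))]
  have habs : |(x - l) * (x - u)| ≤ (u - l) ^ 2 / 4 := by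
    rw [abs_of_nonpos hP0]; linarith
  have h2 : -(|a₂| * (u - l) ^ 2 / 4) ≤ a₂ * ((x - l) * (x - u)) := by
    have h := neg_abs_le (a₂ * ((x - l) * (x - u)))
    rw [abs_mul] at h
    have h' : |a₂| * |(x - l) * (x - u)| ≤ |a₂| * ((u - l) ^ 2 / 4) :=
      mul_le_mul_of_nonneg_left habs (abs_nonneg _)
    linarith
  have h3 : 0 < (u - l) * (a₀ + a₁ * x + a₂ * x ^ 2) := by
    rw [hid]
    have hul : 0 < u - l := sub_pos.mpr hlu
    nlinarith
  rcases pos_and_pos_or_neg_and_neg_of_mul_pos h3 with ⟨-, h⟩ | ⟨h, -⟩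
  · exact h
  · linarith

/-- **A quadratic is NEGATIVE on `[l, u]`** under the mirrored endpoint test. [cite: Cohen1993, §4.1.3 (Algorithm 4.1.11)] -/
theorem quadratic_neg_of_endpoints {a₀ a₁ a₂ l u m x : ℝ} (hl : l ≤ x) (hu : x ≤ u) (hm : 0 < m)
    (hfl : a₀ + a₁ * l + a₂ * l ^ 2 ≤ -m) (hfu : a₀ + a₁ * u + a₂ * u ^ 2 ≤ -m)
    (ha : |a₂| * (u - l) ^ 2 < 4 * m) : a₀ + a₁ * x + a₂ * x ^ 2 < 0 := by
  have h := quadratic_pos_of_endpoints (a₀ := -a₀) (a₁ := -a₁) (a₂ := -a₂) hl hu hm (by linarith) (by linarith)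
    (by rwa [abs_neg])
  linarith

/-- **A real cubic has a root in `(l, u)` if it is negative at `l` and positive at `u`** (intermediate value theorem).
[cite: Cohen1993, §4.1.3 (real roots and the signature; Algorithm 4.1.11)] -/
theorem exists_cubic_root_Ioo_of_neg_of_pos {p q r l u : ℝ} (hlu : l < u) (hl : l ^ 3 + p * l ^ 2 + q * l + r < 0)
    (hu : 0 < u ^ 3 + p * u ^ 2 + q * u + r) : ∃ x : ℝ, l < x ∧ x < u ∧ x ^ 3 + p * x ^ 2 + q * x + r = 0 := by
  set f : ℝ → ℝ := fun x => x ^ 3 + p * x ^ 2 + q * x + r with hf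
  have hcont : ContinuousOn f (Set.Icc l u) := by
    apply Continuous.continuousOn; rw [hf]; fun_prop
  have h0 : (0 : ℝ) ∈ Set.Ioo (f l) (f u) := ⟨hl, hu⟩
  obtain ⟨x, ⟨hxl, hxu⟩, hx⟩ := intermediate_value_Ioo hlu.le hcont h0
  exact ⟨x, hxl, hxu, hx⟩

/-- **A real cubic has a root in `(l, u)` if it is positive at `l` and negative at `u`**. [cite: Cohen1993, §4.1.3 (Algorithm 4.1.11)] -/
theorem exists_cubic_root_Ioo_of_pos_of_neg {p q r l u : ℝ} (hlu : l < u) (hl : 0 < l ^ 3 + p * l ^ 2 + q * l + r)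
    (hu : u ^ 3 + p * u ^ 2 + q * u + r < 0) : ∃ x : ℝ, l < x ∧ x < u ∧ x ^ 3 + p * x ^ 2 + q * x + r = 0 := by
  set f : ℝ → ℝ := fun x => x ^ 3 + p * x ^ 2 + q * x + r with hf
  have hcont : ContinuousOn f (Set.Icc l u) := by
    apply Continuous.continuousOn; rw [hf]; fun_prop
  have h0 : (0 : ℝ) ∈ Set.Ioo (f u) (f l) := ⟨hu, hl⟩
  obtain ⟨x, ⟨hxl, hxu⟩, hx⟩ := intermediate_value_Ioo' hlu.le hcont h0
  exact ⟨x, hxl, hxu, hx⟩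

/-! ### §2 Real embeddings of `ℚ(θ)` from real roots -/

/-- **A real root gives a real embedding**: `θ ∈ ℚ̄` a root of an irreducible monic rational cubic `P`, `x ∈ ℝ` a real root of `P` ⟹
there is a ring homomorphism `ρ : ℚ(θ) → ℝ` with `ρ(θ) = x` (the embeddings of `ℚ(θ)` correspond to the roots of the minimal
polynomial). [cite: Cohen1993, §4.1.3 (Def. 4.1.9: the real embeddings of `ℚ(θ)` are given by the real roots of `T`)] -/
theorem exists_ringHom_adjoin_apply_gen_eq {θ : AlgebraicClosure ℚ} {P : Cubic ℚ} (ha : P.a = 1)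
    (hirr : Irreducible P.toPoly) (hθ : aeval θ P.toPoly = 0) {x : ℝ} (hx : aeval x P.toPoly = 0) :
    ∃ ρ : IntermediateField.adjoin ℚ {θ} →+* ℝ, ρ (IntermediateField.AdjoinSimple.gen ℚ θ) = x := by
  have hmonic : P.toPoly.Monic := Cubic.monic_of_a_eq_one ha
  have hθint : IsIntegral ℚ θ := ⟨_, hmonic, by rwa [← aeval_def]⟩
  have hmin : minpoly ℚ θ = P.toPoly := (minpoly.eq_of_irreducible_of_monic hirr hθ hmonic).symm
  have hmem : x ∈ (minpoly ℚ θ).aroots ℝ := by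
    rw [Polynomial.mem_aroots, hmin]
    exact ⟨hmonic.ne_zero, hx⟩
  refine ⟨((IntermediateField.algHomAdjoinIntegralEquiv ℚ hθint).symm ⟨x, hmem⟩).toRingHom, ?_⟩
  exact IntermediateField.algHomAdjoinIntegralEquiv_symm_apply_gen ℚ hθint ⟨x, hmem⟩

/-! ### §3 Three real embeddings of a cubic field: totally real, and these are all -/

/-- `#(K →+* ℝ) = r₁(K)` (real embeddings versus real complex embeddings). [cite: FrohlichTaylor1990, Ch. V §1, p. 163] -/
private theorem card_ringHom_real_eq_nrRealPlaces {K : Type} [Field K] [NumberField K] :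
    Fintype.card (K →+* ℝ) = InfinitePlace.nrRealPlaces K := by
  classical
  have hreal : ∀ ρ : K →+* ℝ, ComplexEmbedding.IsReal (Complex.ofRealHom.comp ρ) := fun ρ ↦ by
    ext x; simp [ComplexEmbedding.conjugate_coe_eq]
  let e : (K →+* ℝ) ≃ {φ : K →+* ℂ // ComplexEmbedding.IsReal φ} :=
    { toFun := fun ρ ↦ ⟨Complex.ofRealHom.comp ρ, hreal ρ⟩
      invFun := fun φ ↦ φ.2.embedding
      left_inv := fun ρ ↦ by
        ext x
        exact Complex.ofReal_injective (ComplexEmbedding.IsReal.coe_embedding_apply (hreal ρ) x)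
      right_inv := fun φ ↦ by
        apply Subtype.ext
        ext1 x
        exact φ.2.coe_embedding_apply x }
  rw [Fintype.card_congr e, InfinitePlace.card_real_embeddings]

/-- **`[K : ℚ] = 3` with three distinct real embeddings ⟹ exactly three real embeddings** (`r₁ ≤ r₁ + 2 r₂ = 3`).
[cite: Cohen1993, §4.1.3 (Def. 4.1.9, `r₁ + 2 r₂ = n`)] -/
theorem card_ringHom_real_eq_three {K : Type} [Field K] [NumberField K] (h3 : Module.finrank ℚ K = 3)
    (ρ : Fin 3 → (K →+* ℝ)) (hρ : Function.Injective ρ) : Fintype.card (K →+* ℝ) = 3 := by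
  have hge : 3 ≤ Fintype.card (K →+* ℝ) := by
    have h := Fintype.card_le_of_injective ρ hρ
    rwa [Fintype.card_fin] at h
  have h := InfinitePlace.card_add_two_mul_card_eq_rank K
  rw [h3, ← card_ringHom_real_eq_nrRealPlaces] at h
  omega

/-- **`[K : ℚ] = 3` with three distinct real embeddings ⟹ `K` is totally real** (`r₁ + 2 r₂ = 3` and `r₁ ≥ 3` force `r₂ = 0`).
[cite: Cohen1993, §4.1.3 (Def. 4.1.9, `r₁ + 2 r₂ = n`)] -/
theorem isTotallyReal_of_three_realEmbeddings {K : Type} [Field K] [NumberField K] (h3 : Module.finrank ℚ K = 3)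
    (ρ : Fin 3 → (K →+* ℝ)) (hρ : Function.Injective ρ) : IsTotallyReal K := by
  have hcard := card_ringHom_real_eq_three h3 ρ hρ
  rw [card_ringHom_real_eq_nrRealPlaces] at hcard
  have h := InfinitePlace.card_add_two_mul_card_eq_rank K
  rw [h3] at h
  have h0 : InfinitePlace.nrComplexPlaces K = 0 := by omega
  exact NumberField.nrComplexPlaces_eq_zero_iff.mp h0

/-! ### §4 The unit signature certificate -/

section Signature

open Literature.Geometry.Kaehler.ComplexTorus

/-- **Units of EVERY signature from a two-unit certificate (cubic fields).** `[K : ℚ] = 3`, `ρ₀, ρ₁, ρ₂` distinct real embeddings,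
`e₁, e₂ ∈ 𝓞_Kˣ` with sign bits `s₁, s₂ : Fin 3 → 𝔽₂` at `(ρ₀, ρ₁, ρ₂)` (`sᵢ(j) = sign(eᵢ)(ρⱼ)`) such that the eight units `(−1)^a e₁^b e₂^c`
have eight distinct predicted sign vectors `(a + b s₁(j) + c s₂(j))_j` (`hind`, decidable) ⟹ the unit signature map
`sign : 𝓞_Kˣ → 𝔽₂^{(K ↪ ℝ)}` is ONTO (the `ρⱼ` are all the real embeddings, §3). [cite: FrohlichTaylor1990, Ch. V §1 (1.12)–(1.13), p. 164] -/
theorem signVec_surjective_of_two_units {K : Type} [Field K] [NumberField K] (h3 : Module.finrank ℚ K = 3)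
    (ρ : Fin 3 → (K →+* ℝ)) (hρ : Function.Injective ρ) (e₁ e₂ : (𝓞 K)ˣ) (s₁ s₂ : Fin 3 → ZMod 2)
    (hs₁ : ∀ j, signVec e₁ (ρ j) = s₁ j) (hs₂ : ∀ j, signVec e₂ (ρ j) = s₂ j)
    (hind : Function.Injective fun e : ZMod 2 × ZMod 2 × ZMod 2 => fun j : Fin 3 => e.1 + e.2.1 * s₁ j + e.2.2 * s₂ j) :
    Function.Surjective (signVec (K := K)) := by
  classical
  -- `ρ` is a bijection onto the real embeddings
  have hbij : Function.Bijective ρ :=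
    (Fintype.bijective_iff_injective_and_card ρ).mpr ⟨hρ, by rw [Fintype.card_fin, card_ringHom_real_eq_three h3 ρ hρ]⟩
  -- the prediction map is a bijection of two `8`-element sets
  set F : ZMod 2 × ZMod 2 × ZMod 2 → (Fin 3 → ZMod 2) :=
    fun e => fun j : Fin 3 => e.1 + e.2.1 * s₁ j + e.2.2 * s₂ j with hF
  have hFbij : Function.Bijective F :=
    (Fintype.bijective_iff_injective_and_card F).mpr ⟨hind, by simp⟩
  intro f
  obtain ⟨e, he⟩ := hFbij.2 fun j => f (ρ j)
  refine ⟨(-1) ^ e.1.val * e₁ ^ e.2.1.val * e₂ ^ e.2.2.val, funext fun σ => ?_⟩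
  obtain ⟨j, rfl⟩ := hbij.2 σ
  have hj := congrFun he j
  simp only [hF] at hj
  rw [signVec_mul, signVec_mul, signVec_pow, signVec_pow, signVec_pow, signVec_neg_one]
  simp only [Pi.add_apply, Pi.smul_apply]
  simp only [nsmul_eq_mul, ZMod.natCast_zmod_val, mul_one, hs₁, hs₂]
  exact hj

/-- **The sign bit of a «polynomial» unit at a real embedding, negative case**: if `(e : K) = a₀ + a₁ t + a₂ t²`, `ρ t = x` and
`a₀ + a₁ x + a₂ x² < 0` then `sign(e)(ρ) = 1`. [cite: FrohlichTaylor1990, Ch. V §1 (1.10), p. 163] -/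
theorem signVec_apply_eq_one_of_neg {K : Type} [Field K] [NumberField K] (ρ : K →+* ℝ) (e : (𝓞 K)ˣ) {t : K} {x : ℝ}
    (hx : ρ t = x) {a₀ a₁ a₂ : ℤ} (he : ((e : 𝓞 K) : K) = a₀ + a₁ * t + a₂ * t ^ 2)
    (hneg : (a₀ : ℝ) + a₁ * x + a₂ * x ^ 2 < 0) : signVec e ρ = 1 := by
  rw [signVec_apply, he, map_add, map_add, map_mul, map_mul, map_pow, hx, map_intCast, map_intCast, map_intCast, if_pos hneg]

/-- **The sign bit of a «polynomial» unit at a real embedding, positive case**: if `(e : K) = a₀ + a₁ t + a₂ t²`, `ρ t = x` and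
`0 < a₀ + a₁ x + a₂ x²` then `sign(e)(ρ) = 0`. [cite: FrohlichTaylor1990, Ch. V §1 (1.10), p. 163] -/
theorem signVec_apply_eq_zero_of_pos {K : Type} [Field K] [NumberField K] (ρ : K →+* ℝ) (e : (𝓞 K)ˣ) {t : K} {x : ℝ}
    (hx : ρ t = x) {a₀ a₁ a₂ : ℤ} (he : ((e : 𝓞 K) : K) = a₀ + a₁ * t + a₂ * t ^ 2)
    (hpos : 0 < (a₀ : ℝ) + a₁ * x + a₂ * x ^ 2) : signVec e ρ = 0 := by
  rw [signVec_apply, he, map_add, map_add, map_mul, map_mul, map_pow, hx, map_intCast, map_intCast, map_intCast,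
    if_neg (not_lt.mpr hpos.le)]

end Signature

/-! ### §5 The complex case: exactly one real embedding (appended, k4-w1 GEN 8) -/

/-- **`ℚ(θ) ⊂ ℚ̄` has exactly ONE ring homomorphism to `ℝ`** when `θ` is a root of a monic rational cubic with NEGATIVE discriminant and
`[ℚ(θ) : ℚ] = 3` (`#(K →+* ℝ) = r₁(K) = 1`, `CubicFieldOneRealPlace`). [cite: Cohen1993, Prop. 4.8.11 and §4.1.3 (Def. 4.1.9)] -/
theorem card_ringHom_real_adjoin_eq_one_of_cubic_discr_neg {θ : AlgebraicClosure ℚ} {P : Cubic ℚ} (ha : P.a = 1)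
    (hd : P.discr < 0) (hθ : aeval θ P.toPoly = 0) (h3 : Module.finrank ℚ (IntermediateField.adjoin ℚ {θ}) = 3) :
    haveI : FiniteDimensional ℚ (IntermediateField.adjoin ℚ {θ}) := Module.finite_of_finrank_eq_succ h3
    haveI : NumberField (IntermediateField.adjoin ℚ {θ}) := NumberField.mk
    Fintype.card (IntermediateField.adjoin ℚ {θ} →+* ℝ) = 1 := by
  haveI : FiniteDimensional ℚ (IntermediateField.adjoin ℚ {θ}) := Module.finite_of_finrank_eq_succ h3
  haveI : NumberField (IntermediateField.adjoin ℚ {θ}) := NumberField.mk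
  classical
  rw [card_ringHom_real_eq_nrRealPlaces]
  have h := card_isReal_adjoin_eq_one_of_cubic_discr_neg ha hd hθ h3
  rw [Nat.card_eq_fintype_card] at h
  exact h

/-- **At most one real embedding of a complex cubic field `ℚ(θ)`** (`Subsingleton (ℚ(θ) →+* ℝ)`), the hypothesis shape of the
cell's `ℓ = 2` ascent door (cruxlead-19573-w2, `classicalMuVanishes_restrict_rat_of_quadratic_of_subsingleton_realEmbedding`).
[cite: Cohen1993, Prop. 4.8.11 and §4.1.3 (Def. 4.1.9)] -/
theorem subsingleton_ringHom_real_adjoin_of_cubic_discr_neg {θ : AlgebraicClosure ℚ} {P : Cubic ℚ} (ha : P.a = 1)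
    (hd : P.discr < 0) (hθ : aeval θ P.toPoly = 0) (h3 : Module.finrank ℚ (IntermediateField.adjoin ℚ {θ}) = 3) :
    Subsingleton (IntermediateField.adjoin ℚ {θ} →+* ℝ) := by
  haveI : FiniteDimensional ℚ (IntermediateField.adjoin ℚ {θ}) := Module.finite_of_finrank_eq_succ h3
  haveI : NumberField (IntermediateField.adjoin ℚ {θ}) := NumberField.mk
  classical
  exact Fintype.card_le_one_iff_subsingleton.mp (card_ringHom_real_adjoin_eq_one_of_cubic_discr_neg ha hd hθ h3).le

end Literature.NumberTheory.NumberFields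

end
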